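/-
Copyright (c) 2026. All rights reserved.
Released under Apache 2.0 license as described in the file LICENSE.
Authors: HodgeCM publication cell (pub-hodgecm), GR lane, seat GR-1 (`pub-hodgecm-own-real34`).
-/
import Literature.NumberTheory.Automorphic.UnitaryGroupArchRealPair
import HarnessLib

/-!
# The sign of the determinant at a real place of `E`: a continuous order-two character of `U(J)(E ⊗ ℝ)`

Topic `NumberTheory/GelbartRogawski1991`; namespace
`Literature.NumberTheory.GelbartRogawski1991.UnitaryDualPair.ArchSplitting.QuadExt` (companion of `detAtC` of
`QuadExtSplittingCharArchTwistComplex`).  Two small definitions with bodies and their API; no `def … : Prop`, no named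
fact, no `sorry`.

For a real place `w` of the number field `E` and `g ∈ U(J)(E ⊗ ℝ) ≤ GL_N(E ⊗ ℝ)` (`UnitaryGroup.arch`), the
`w`-coordinate `g_w = (g_{ij})_w ∈ GL_N(ℝ)` (`UnitaryGroup.evalR`) has a non-zero real determinant; its SIGN is a
continuous character of order `≤ 2`:

* `unitSignHom : ℝˣ →* ℂˣ`, `u ↦ u/|u|` (`= ±1`);
* **`detSignAtR w : U(J)(E ⊗ ℝ) →* ℂˣ`**, `g ↦ sign det g_w = det g_w / |det g_w|`; `coe_detSignAtR` (formula),
  `detSignAtR_mul_self` (`s² = 1`), `continuous_detSignAtR`, `coe_detSignAtR_of_pos` / `coe_detSignAtR_of_neg` (`= 1` on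
  `det g_w > 0`, `= −1` on `det g_w < 0`), `coe_detSignAtR_eq_one_or`.

At a real place `v` of `F` split in the quadratic extension `E` (`w ∣ v` real; [GelbartRogawski1991, Prop. 3.1.1], type
(ii)) `U(J)(F_v) ≅ GL_N(ℝ)` through `g ↦ g_w`, every continuous character of it is `φ ∘ det`, and `detSignAtR w` is
the one order-two twist available to the archimedean half of the doubled Weil representation: it is the `s_v` of
`DoubledWeilRepresentationArchLiftSigns.exists_isArchHalf_twist_prod_signs` (it flips the value at the single Levi sign
representative and fixes the pair representative).  [Kudla1994, §3, case `E_v = F_v ⊕ F_v`]; [Adams2007, §5 Rem. 5.6]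
(the `det^{1/2}` cover of `GL_N(ℝ)`).

## References

* S. S. Kudla, Israel J. Math. 87 (1994), §3 [Kudla1994].
* J. Adams, *The theta correspondence over ℝ* (2007), §5 Rem. 5.6 [Adams2007].
* S. Gelbart, J. Rogawski, Invent. Math. 105 (1991), §3.1 Prop. 3.1.1 p. 455 [GelbartRogawski1991].
-/

set_option autoImplicit false

noncomputable section

open scoped Matrix MatrixGroups
open NumberField NumberField.InfinitePlace NumberField.mixedEmbedding
open _root_.Literature.NumberTheory.Automorphic _root_.Literature.NumberTheory.Automorphic.UnitaryGroup

namespace Literature.NumberTheory.GelbartRogawski1991.UnitaryDualPair.ArchSplitting.QuadExt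

/-! ## §1 The sign of a real unit as a unit complex number -/

/-- the sign `u/|u| ∈ {±1} ⊂ ℂˣ` of a real unit `u`, as a homomorphism `ℝˣ →* ℂˣ`. [cite: Adams2007, §5 Rem. 5.6] -/
def unitSignHom : ℝˣ →* ℂˣ where
  toFun u := Units.mk0 ((((u : ℝ) / |(u : ℝ)| : ℝ)) : ℂ)
    (Complex.ofReal_ne_zero.2 (div_ne_zero u.ne_zero (abs_ne_zero.2 u.ne_zero)))
  map_one' := Units.ext (by simp)
  map_mul' u v := Units.ext (by
    simp only [Units.val_mul, Units.val_mk0, abs_mul, ← Complex.ofReal_mul]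
    rw [div_mul_div_comm])

/-- formula. [cite: Adams2007, §5 Rem. 5.6] -/
@[simp] theorem coe_unitSignHom (u : ℝˣ) : ((unitSignHom u : ℂˣ) : ℂ) = (((u : ℝ) / |(u : ℝ)| : ℝ) : ℂ) := rfl

/-- `u/|u| = 1` for `u > 0`. [cite: Adams2007, §5 Rem. 5.6] -/
theorem coe_unitSignHom_of_pos {u : ℝˣ} (hu : 0 < (u : ℝ)) : ((unitSignHom u : ℂˣ) : ℂ) = 1 := by
  rw [coe_unitSignHom, abs_of_pos hu, div_self hu.ne', Complex.ofReal_one]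

/-- `u/|u| = −1` for `u < 0`. [cite: Adams2007, §5 Rem. 5.6] -/
theorem coe_unitSignHom_of_neg {u : ℝˣ} (hu : (u : ℝ) < 0) : ((unitSignHom u : ℂˣ) : ℂ) = -1 := by
  rw [coe_unitSignHom, abs_of_neg hu, div_neg, div_self hu.ne, Complex.ofReal_neg, Complex.ofReal_one]

/-- `(u/|u|)² = 1`. [cite: Adams2007, §5 Rem. 5.6] -/
theorem unitSignHom_mul_self (u : ℝˣ) : unitSignHom u * unitSignHom u = 1 := by
  refine Units.ext ?_
  rcases lt_or_gt_of_ne u.ne_zero with h | h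
  · rw [Units.val_mul, coe_unitSignHom_of_neg h, Units.val_one]; norm_num
  · rw [Units.val_mul, coe_unitSignHom_of_pos h, Units.val_one, one_mul]

/-! ## §2 The sign of `det g_w` at a real place `w` of `E` -/

variable (F E : Type) [Field F] [NumberField F] [Field E] [NumberField E] [Algebra F E]
  (c : E ≃ₐ[F] E) {N : ℕ} (J : Matrix (Fin N) (Fin N) E)

/-- **`detSignAtR w : U(J)(E ⊗ ℝ) →* ℂˣ`, `g ↦ sign (det g_w)`** (`g_w` the `w`-coordinate of `g`, `w` a real place of
`E`). [cite: Kudla1994, §3] [cite: Adams2007, §5 Rem. 5.6] -/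
def detSignAtR (w : {w : InfinitePlace E // w.IsReal}) : arch F E c N J →* ℂˣ :=
  unitSignHom.comp ((Units.map (evalR E w : mixedSpace E →+* ℝ).toMonoidHom).comp
    ((Matrix.GeneralLinearGroup.det : GL (Fin N) (mixedSpace E) →* (mixedSpace E)ˣ).comp (arch F E c N J).subtype))

omit [NumberField F] [NumberField E] in
/-- the real unit `det g_w`. [cite: Kudla1994, §3] -/
theorem coe_map_det (w : {w : InfinitePlace E // w.IsReal}) (g : arch F E c N J) :
    (((Units.map (evalR E w : mixedSpace E →+* ℝ).toMonoidHom).comp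
        ((Matrix.GeneralLinearGroup.det : GL (Fin N) (mixedSpace E) →* (mixedSpace E)ˣ).comp (arch F E c N J).subtype) g :
          ℝˣ) : ℝ) =
      ((((g : GL (Fin N) (mixedSpace E)) : Matrix (Fin N) (Fin N) (mixedSpace E))).map (evalR E w)).det := by
  simp only [MonoidHom.comp_apply, Subgroup.coe_subtype, Units.coe_map, RingHom.toMonoidHom_eq_coe,
    MonoidHom.coe_coe, Matrix.GeneralLinearGroup.val_det_apply, RingHom.map_det, RingHom.mapMatrix_apply]

omit [NumberField F] [NumberField E] in
/-- formula: `detSignAtR w g = det g_w / |det g_w|`. [cite: Kudla1994, §3] -/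
theorem coe_detSignAtR (w : {w : InfinitePlace E // w.IsReal}) (g : arch F E c N J) :
    ((detSignAtR F E c J w g : ℂˣ) : ℂ) =
      ((((((g : GL (Fin N) (mixedSpace E)) : Matrix (Fin N) (Fin N) (mixedSpace E))).map (evalR E w)).det /
        |((((g : GL (Fin N) (mixedSpace E)) : Matrix (Fin N) (Fin N) (mixedSpace E))).map (evalR E w)).det| : ℝ) : ℂ) := by
  rw [detSignAtR, MonoidHom.comp_apply, coe_unitSignHom, coe_map_det]

omit [NumberField F] [NumberField E] in
/-- `det g_w ≠ 0`. [cite: Kudla1994, §3] -/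
theorem det_map_evalR_ne_zero (w : {w : InfinitePlace E // w.IsReal}) (g : arch F E c N J) :
    ((((g : GL (Fin N) (mixedSpace E)) : Matrix (Fin N) (Fin N) (mixedSpace E))).map (evalR E w)).det ≠ 0 := by
  rw [← coe_map_det]
  exact Units.ne_zero _

omit [NumberField F] [NumberField E] in
/-- **`detSignAtR w g = 1` when `det g_w > 0`.** [cite: Kudla1994, §3] -/
theorem coe_detSignAtR_of_pos (w : {w : InfinitePlace E // w.IsReal}) (g : arch F E c N J)
    (h : 0 < ((((g : GL (Fin N) (mixedSpace E)) : Matrix (Fin N) (Fin N) (mixedSpace E))).map (evalR E w)).det) :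
    ((detSignAtR F E c J w g : ℂˣ) : ℂ) = 1 := by
  rw [coe_detSignAtR, abs_of_pos h, div_self h.ne', Complex.ofReal_one]

omit [NumberField F] [NumberField E] in
/-- **`detSignAtR w g = −1` when `det g_w < 0`.** [cite: Kudla1994, §3] -/
theorem coe_detSignAtR_of_neg (w : {w : InfinitePlace E // w.IsReal}) (g : arch F E c N J)
    (h : ((((g : GL (Fin N) (mixedSpace E)) : Matrix (Fin N) (Fin N) (mixedSpace E))).map (evalR E w)).det < 0) :
    ((detSignAtR F E c J w g : ℂˣ) : ℂ) = -1 := by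
  rw [coe_detSignAtR, abs_of_neg h, div_neg, div_self h.ne, Complex.ofReal_neg, Complex.ofReal_one]

omit [NumberField F] [NumberField E] in
/-- `detSignAtR w g ∈ {1, −1}`. [cite: Kudla1994, §3] -/
theorem coe_detSignAtR_eq_one_or (w : {w : InfinitePlace E // w.IsReal}) (g : arch F E c N J) :
    ((detSignAtR F E c J w g : ℂˣ) : ℂ) = 1 ∨ ((detSignAtR F E c J w g : ℂˣ) : ℂ) = -1 := by
  rcases lt_or_gt_of_ne (det_map_evalR_ne_zero F E c J w g) with h | h
  · exact Or.inr (coe_detSignAtR_of_neg F E c J w g h)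
  · exact Or.inl (coe_detSignAtR_of_pos F E c J w g h)

omit [NumberField F] [NumberField E] in
/-- **`(detSignAtR w g)² = 1`.** [cite: Kudla1994, §3] -/
theorem detSignAtR_mul_self (w : {w : InfinitePlace E // w.IsReal}) (g : arch F E c N J) :
    detSignAtR F E c J w g * detSignAtR F E c J w g = 1 := by
  rw [detSignAtR, MonoidHom.comp_apply]
  exact unitSignHom_mul_self _

omit [NumberField F] [NumberField E] in
/-- **`detSignAtR w` is continuous** (`det g_w` is continuous and never `0`; `x ↦ x/|x|` is continuous off `0`).
[cite: Kudla1994, §3] -/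
theorem continuous_detSignAtR (w : {w : InfinitePlace E // w.IsReal}) :
    Continuous fun g : arch F E c N J => ((detSignAtR F E c J w g : ℂˣ) : ℂ) := by
  simp only [coe_detSignAtR]
  have hev : Continuous (evalR E w : mixedSpace E → ℝ) := (continuous_apply w).comp continuous_fst
  have hdet : Continuous fun g : arch F E c N J =>
      ((((g : GL (Fin N) (mixedSpace E)) : Matrix (Fin N) (Fin N) (mixedSpace E))).map (evalR E w)).det :=
    ((Units.continuous_val.comp continuous_subtype_val).matrix_map hev).matrix_det
  exact Complex.continuous_ofReal.comp
    (hdet.div (continuous_abs.comp hdet) fun g => abs_ne_zero.2 (det_map_evalR_ne_zero F E c J w g))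

end Literature.NumberTheory.GelbartRogawski1991.UnitaryDualPair.ArchSplitting.QuadExt

end
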